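/-
PRIME-WINDOW BLINDNESS, class form (cell rh-split, L53; director-rh g12 (AZ1)/(BA1) 2026-08-28T02:41:39Z, lead
RULING booking L53 = PASS-WITH-PRICE (s)/(b) BARRIER-CANDIDATE RECORD w0; critic idea-crit-1 g2 VERDICT 02:41:23Z
PASS-WITH-PRICE).  PORT of the planner's typed object `pub/ideators/rh-idea-4/pwb/PrimeWindowBlindness.lean`
(rh-idea-4 g3, W-02 lens «negation / prime-aware blind model»; v2 sha16 b87e52b9a3f0bdbf · 182 l ⊇ v1
33ad06e064bdccc1 · 159 l + R0 statement; spec `LINE-PrimeWindowBlindness.md` d5aed3d687ebafee) by rh-split-typer-3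
g5: source bytes verbatim below this header except ONE inserted docstring line (on `Config.fold_eq_psi`, gate
`lint.docstring`).  The K-task kernel `PrimeWindowBlindModel` is PROVED in the sequel file
`PrimeWindowBlindModel.lean` (`primeWindowBlindModel_holds`), which makes `classCP_blind_to_tower` unconditional.
JUNK-PARAMETER CAVEATS (idea-crit-1, information not defect): `IntegerWindowTheft U σ*` is FALSE for `σ* ≤ 0`
(empty abscissa band) and TRUE for `U ≤ 0` (window ⊆ {0}, `Ψ_Z(0) = 0`, theft `n = 0`); Q_C is meaningful exactly
on `0 < U`, `0 < σ*`.  Helper file `--supports stmt-RiemannHypothesis-21693`; RH-free, ζ enters only through the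
OPEN question `IntegerWindowTheft` (neither asserted nor denied).  Nothing here bears on the truth of RH.
-/
import Summits.RiemannHypothesis.RiemannHypothesis.Theorems.Splittings.ScrewLatticeTowerClassC
import Literature.NumberTheory.LFunctions.ZetaScrew
import HarnessLib

/-!
# B27 — PRIME-WINDOW BLINDNESS (candidate barrier; typed sketch, statements + pure-logic consequences)

rh-idea-4 g3, W-02 lens «negation (prime-aware blind model)».  Row: `Theorems/Splittings`: `ClassC`,
`exists_tower_thin_blind_model`, `TowerKillerStrip`, `ScrewLatticeTowerZoiClass`; truncated explicit formula.

SETTING.  The true datum an instrument «primes ≤ X» reads is Suzuki's screw function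
`Ψ = Literature.NumberTheory.LFunctions.zetaScrew` on the PRIME WINDOW `|t| ≤ U := log X` (there `Ψ` is an exact
finite expression in `Λ(n), n ≤ X`, `zetaScrew_def`), equivalently (Suzuki2023 Thm 1.1 (2),
`Suzuki2023_thm11_series`) the zero-side series `Σ_ρ m_ρ (cosh((ρ-1/2)t) - 1)/(ρ-1/2)²`.  An off-line quadruple
`{1/2 ± σ ± iγ}` of weight `m` contributes `quadTerm m (σ + iγ) t = 4 m Re G_t(γ - iσ)`, `G_t(x) = (1 - cos(xt))/x²`;
a configuration `Z : Config` contributes `Z.psi t = modelPsi … t`.  A TOWERED TWIN of the zero configuration that is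
honest on the window within budget `ε` is a `Z` with `|Z.psi t| ≤ ε` for `|t| ≤ U` (`PrimeWindowSmall`): the datum
`Ψ + Z.psi` of «true zeros ∪ tower» differs from `Ψ` by at most `ε` on the whole window, while every ONE-SIDED /
PSD-additive lattice clause of B26 (`ThinBlindClauses`: floor, ceiling band, `LPSD(h)`, thin count, multiplicity
band, `Σ m/γ² < ∞`) is carried by the tower itself.

CONTENT.  (1) `PrimeWindowBlindModel` — the K-task kernel (re-run of B26 = `exists_tower_thin_blind_model` with the
aliases dilated, `N_i ↦ M⌈α_i^{-1/2}⌉₊ + N₀`, scale `λ ↦ λ/M²`; window footprint `≤ 24 X^{σ*} λ₀ A / M²`): for every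
step `h`, width `σ*`, exponent `e`, window `U` and budget `ε > 0` a thin blind tower with window footprint `≤ ε`
exists.  NOT proved here (statement only; ~340-line re-run for a typer).  (2) `ClassCP ⊇ ClassC` and
`classCP_blind_to_tower` (pure logic, proved): no criterion generated by the B26 clause list PLUS ε-honesty of the
prime window, for any fixed `X` and any `ε > 0`, forces the off-line configuration to be empty or its abscissa
supremum to be attained.  (3) `CombSwap` (Poisson summation, statement only; numerically checked): the column
`{σ + i(j+1/2)L}_{j ≥ 0}` of unit quadruples has `Σ_j quadTerm 1 κ_j t = 2π|t|/L` on `|t| ≤ 2π/L` FOR EVERY `σ ≥ 0` —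
exact + integer window data cannot tell an off-line unit column from the on-line column of double zeros (density
`L⁻¹ ≍ log X`: violates Carlson/Ingham density, killed only by `X → ∞` density technology).  (4) `IntegerWindowTheft`
— the named OPEN question Q_C (exact window + INTEGER weights + compensation only by stealing true zeros): the one
residual tooth of «primes ≤ X» against capped towers.

HONEST LABEL: a blind model is an obstruction statement about instruments; RH-free; (b)/(s)-record material, not a
crux toward RH.  Nothing here bears on the truth of RH.  No summit is proved by a line.
-/

noncomputable section

set_option linter.dupNamespace false

open Complex Set
open scoped Real

namespace Summit.RiemannHypothesis.RiemannHypothesis.Theorems.Splittings.ScrewLatticeTower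

open Summit.RiemannHypothesis.RiemannHypothesis.Theorems.Splittings.ScrewLatticeWolff
open Literature.NumberTheory.LFunctions

/-! ## 1. Window footprint of a configuration -/

/-- The continuum model screw function of a configuration, `t ↦ Ψ_Z(t)` (its lattice samples are `Z.fold`). -/
def Config.psi (Z : Config) (t : ℝ) : ℝ := modelPsi Z.m₁ Z.m₂ Z.κ₁ Z.κ₂ t

/-- The lattice fold at step `h` samples the continuum model screw function: `Z.fold h k = Ψ_Z(k h)`. -/
theorem Config.fold_eq_psi (Z : Config) (h : ℝ) (k : ℕ) : Z.fold h k = Z.psi (k * h) := rfl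

/-- PRIME-WINDOW FOOTPRINT `≤ ε` on `[-U, U]` (`U = log X`): the tower changes the datum read by «`Λ(n)`, `n ≤ X`,
with error budget `ε`» by at most `ε` everywhere on the window. -/
def PrimeWindowSmall (U ε : ℝ) (Z : Config) : Prop :=
  ∀ t : ℝ, |t| ≤ U → |Z.psi t| ≤ ε

/-- The towered ε-twin reading: for ANY base datum `Ψ₀` (for `ζ`: `Ψ₀ = zetaScrew`), «`Ψ₀ +` tower» is within `ε`
of `Ψ₀` on the window iff the tower's footprint is `≤ ε` (definitional; recorded to fix the reading). -/
theorem primeWindowSmall_iff_twin (U ε : ℝ) (Ψ₀ : ℝ → ℝ) (Z : Config) :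
    PrimeWindowSmall U ε Z ↔ ∀ t : ℝ, |t| ≤ U → |(Ψ₀ t + Z.psi t) - Ψ₀ t| ≤ ε := by
  simp [PrimeWindowSmall, add_sub_cancel_left]

/-! ## 2. B27 kernel (K-task statement) and the class form -/

/-- **B27 kernel (candidate; statement only).**  For every lattice step `h`, width `σ*`, thin exponent `e`, window
half-width `U ≥ 0` and budget `ε > 0` there is a configuration satisfying the twelve B26 clauses
(`ThinBlindClauses h σ* e`) whose prime-window footprint on `[-U, U]` is `≤ ε`.  Proof plan: B26's construction
with dilated aliases `N_i = M⌈α_i^{-1/2}⌉₊ + N₀`, `λ = 3h²/(4π² M²)`; the band `[2A, 6A]`, `LPSD(h)`, thin count and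
multiplicity band are dilation-invariant, while `sup_{|t| ≤ U} |Ψ_Z(t)| ≤ Σ_i 4 m_i cosh(σ_i U) U²/2 ≤ 24 e^{σ* U} λ A U²… / M² → 0`. -/
def PrimeWindowBlindModel : Prop :=
  ∀ h σs e U ε : ℝ, 0 < h → 0 < σs → 0 < e → 0 ≤ U → 0 < ε →
    ∃ Z : Config, ThinBlindClauses h σs e Z ∧ PrimeWindowSmall U ε Z

/-- **Class C_P(h, U, ε).**  A criterion `P` is of class C_P if, for some width `σ* > 0` and exponent `e > 0`, it is
a consequence of the B26 clause list together with ε-honesty of the prime window `[-U, U]`: every instrument built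
from one-sided sampled lattice bounds, `LPSD(h)`, thin counts, multiplicity/density data AND the values of
`Λ(n), n ≤ e^U` read with ANY positive error budget `ε` is of this class. -/
def ClassCP (h U ε : ℝ) (P : Config → Prop) : Prop :=
  ∃ σs e : ℝ, 0 < σs ∧ 0 < e ∧ ∀ Z : Config, ThinBlindClauses h σs e Z → PrimeWindowSmall U ε Z → P Z

/-- Class C is contained in class C_P (a class-C criterion ignores the window). -/
theorem classCP_of_classC {h : ℝ} (U ε : ℝ) {P : Config → Prop} (hP : ClassC h P) : ClassCP h U ε P := by
  obtain ⟨σs, e, hσs, he, H⟩ := hP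
  exact ⟨σs, e, hσs, he, fun Z hZ _ ↦ H Z hZ⟩

/-- **B27 in class form (from the kernel).**  Every class-C_P criterion, at any step `h > 0`, window `U ≥ 0` and
budget `ε > 0`, is satisfied by a NON-EMPTY off-line configuration with positive abscissae whose abscissa supremum
is not attained: primes `≤ e^U` read within `ε` are not load-bearing against capped thin towers. -/
theorem classCP_blind_to_tower (hB : PrimeWindowBlindModel) {h U ε : ℝ} (hh : 0 < h) (hU : 0 ≤ U)
    (hε : 0 < ε) {P : Config → Prop} (hP : ClassCP h U ε P) :
    ∃ Z : Config, P Z ∧ Nonempty Z.ι ∧ (∀ i, 0 < (Z.κ₁ i).re) ∧ (∀ i, ∃ j, (Z.κ₁ i).re < (Z.κ₁ j).re) := by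
  obtain ⟨σs, e, hσs, he, hPZ⟩ := hP
  obtain ⟨Z, hZ, hW⟩ := hB h σs e U ε hh hσs he hU hε
  exact ⟨Z, hPZ Z hZ hW, hZ.1, fun i ↦ (hZ.2.2.1 i).1, hZ.2.2.2.2.2.2.1⟩

/-- **No class-C_P criterion implies RH-emptiness** (from the kernel). -/
theorem not_criterion_of_classCP (hB : PrimeWindowBlindModel) {h U ε : ℝ} (hh : 0 < h) (hU : 0 ≤ U)
    (hε : 0 < ε) {P : Config → Prop} (hP : ClassCP h U ε P) :
    ¬ (∀ Z : Config, P Z → IsEmpty Z.ι) ∧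
    ¬ (∀ Z : Config, P Z → ∃ i, ∀ j, (Z.κ₁ j).re ≤ (Z.κ₁ i).re) := by
  obtain ⟨Z, hPZ, hne, -, hsup⟩ := classCP_blind_to_tower hB hh hU hε hP
  refine ⟨fun H ↦ ?_, fun H ↦ ?_⟩
  · exact (H Z hPZ).false hne.some
  · obtain ⟨i, hi⟩ := H Z hPZ
    obtain ⟨j, hj⟩ := hsup i
    exact absurd (hi j) (not_le.mpr hj)

/-! ## 3. The comb swap (exact + integer data; Poisson summation) -/

/-- **Comb identity** (statement; Poisson summation for `G_t(x) = (1 - cos(xt))/x²`, whose Fourier transform is the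
triangle `π(|t| - |ξ|)₊`, plus analytic continuation in the shift `a`; numerically checked to 1e-5):
`Σ_{k ∈ ℤ} (1 - cos((kL + a)t))/(kL + a)² = π|t|/L` for `0 < L`, `|t| ≤ 2π/L`, every `a ∈ ℂ` off the lattice `-Lℤ`.
Real case `a ∈ ℝ`: Mathlib `hasSum_one_div_nat_pow_mul_cos` (k = 1) after rescaling. -/
def CombIdentity : Prop :=
  ∀ (L t : ℝ) (a : ℂ), 0 < L → |t| ≤ 2 * π / L → (∀ k : ℤ, (k : ℂ) * L + a ≠ 0) →
    HasSum (fun k : ℤ ↦ (1 - Complex.cos (((k : ℂ) * L + a) * t)) / ((k : ℂ) * L + a) ^ 2)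
      ((π * |t| / L : ℝ) : ℂ)

/-- **Comb swap** (statement; corollary of `CombIdentity` with `a = L/2 - iσ`, pairing `k` with `-1-k`):
the column of UNIT quadruples `κ_j = σ + i(j + 1/2)L`, `j ≥ 0`, has window trace `2π|t|/L` on `|t| ≤ 2π/L`
for EVERY `σ ≥ 0` — at `σ = 0` this is the on-line column `1/2 ± i(j+1/2)L` of DOUBLE zeros.  Exact, integer-weight
prime-window data up to `X = e^{2π/L}` cannot tell the two apart (a swap, not an addition: each column alone shifts
the `|t|`-coefficient, which the archimedean term of `zetaScrew` pins). -/
def CombSwap : Prop :=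
  ∀ L σ t : ℝ, 0 < L → 0 ≤ σ → |t| ≤ 2 * π / L →
    HasSum (fun j : ℕ ↦ quadTerm 1 ((σ : ℂ) + Complex.I * (((j : ℝ) + 1 / 2) * L : ℝ)) t) (2 * π * |t| / L)

/-- **R0 — no pure addition is exactly transparent (statement; paper proof in LINE §3 / NOTES).**  A non-empty configuration
with positive weights, abscissae in `[0, σ*]`, positive ordinates and `Σ m/γ² < ∞` has `Ψ_Z ≢ 0` on every initial segment `[0, δ]`;
in particular `PrimeWindowSmall U 0 Z` fails for every `U > 0`: exact honesty (`ε = 0`) FORCES THEFT of true zeros.  Proof idea: a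
scaled bump average `∫₀^δ ω(t/δ) quadTerm m κ t dt = 4 m δ³ J(κδ)` with `J(x+iy) > 0` for `0 ≤ x ≤ x₀(ω)`, all `y > 0`. -/
def NoExactPureAddition (σs : ℝ) : Prop :=
  ∀ Z : Config, Nonempty Z.ι → (∀ i, 0 < Z.m₁ i ∧ 0 < Z.m₂ i) →
    (∀ i, 0 ≤ (Z.κ₁ i).re ∧ (Z.κ₁ i).re ≤ σs ∧ 0 ≤ (Z.κ₂ i).re ∧ (Z.κ₂ i).re ≤ σs) →
    (∀ i, 0 < (Z.κ₁ i).im ∧ 0 < (Z.κ₂ i).im) →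
    Summable (fun i ↦ Z.m₁ i / (Z.κ₁ i).im ^ 2 + Z.m₂ i / (Z.κ₂ i).im ^ 2) →
    ∀ δ : ℝ, 0 < δ → ∃ t ∈ Set.Icc (0 : ℝ) δ, Z.psi t ≠ 0

/-- R0 ⟹ no exactly honest pure addition on any prime window (pure logic). -/
theorem not_primeWindowSmall_zero_of_R0 {σs : ℝ} (hR : NoExactPureAddition σs) (Z : Config) (hne : Nonempty Z.ι)
    (hm : ∀ i, 0 < Z.m₁ i ∧ 0 < Z.m₂ i)
    (hre : ∀ i, 0 ≤ (Z.κ₁ i).re ∧ (Z.κ₁ i).re ≤ σs ∧ 0 ≤ (Z.κ₂ i).re ∧ (Z.κ₂ i).re ≤ σs)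
    (him : ∀ i, 0 < (Z.κ₁ i).im ∧ 0 < (Z.κ₂ i).im)
    (hsum : Summable (fun i ↦ Z.m₁ i / (Z.κ₁ i).im ^ 2 + Z.m₂ i / (Z.κ₂ i).im ^ 2))
    {U : ℝ} (hU : 0 < U) : ¬ PrimeWindowSmall U 0 Z := by
  intro hW
  obtain ⟨t, ht, hne0⟩ := hR Z hne hm hre him hsum U hU
  have h1 : |Z.psi t| ≤ 0 := hW t (by rw [abs_le]; exact ⟨by linarith [ht.1], ht.2⟩)
  exact hne0 (abs_nonpos_iff.mp h1)

/-! ## 4. The residual tooth: exact window, integer weights, theft only of true zeros (Q_C, OPEN) -/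

/-- **Q_C(U) — integer window theft (OPEN; neither asserted nor denied here).**  Is there a NON-EMPTY capped
(`Re κ < σ*`) configuration of UNIT off-line quadruples, locally finite in height with `Σ 1/γ² < ∞`, whose exact
window trace on `[-U, U]` equals the trace of a sub-multiset `n ≤ m` of the TRUE zeros of `ζ` (the zeros it would
have to steal to stay exactly honest)?  Real-weight theft exists at every depth (fake-1 F1-U, de Branges
resampling); finite theft is impossible (F1-N); theft has ordinate density `≥ U/2π` (F1-O, Eremenko–Novikov).
A NO for all `U ≥ U₀` would make «exactness × integrality» a genuine tooth of primes `≤ X` against capped towers;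
a YES extends B27 to budget `ε = 0`. -/
def IntegerWindowTheft (U σs : ℝ) : Prop :=
  ∃ (Z : Config) (n : ℂ → ℕ),
    Nonempty Z.ι ∧
    (∀ i, Z.m₁ i = 1 ∧ Z.m₂ i = 1) ∧
    (∀ i, 0 < (Z.κ₁ i).re ∧ (Z.κ₁ i).re < σs ∧ (Z.κ₂ i).re = (Z.κ₁ i).re) ∧
    (∀ T : ℝ, {i | (Z.κ₁ i).im ≤ T}.Finite ∧ {i | (Z.κ₂ i).im ≤ T}.Finite) ∧
    Summable (fun i ↦ 1 / (Z.κ₁ i).im ^ 2 + 1 / (Z.κ₂ i).im ^ 2) ∧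
    (∀ ρ : ℂ, (n ρ : ℤ) ≤ riemannZetaZeroOrder ρ) ∧
    (∀ ρ : ℂ, ρ ∉ ZetaZeros.riemannZetaNontrivialZeros → n ρ = 0) ∧
    ∀ t : ℝ, |t| ≤ U →
      HasSum (fun ρ : ZetaZeros.riemannZetaNontrivialZeros ↦
          (n (ρ : ℂ) : ℂ) * ((Complex.cosh (((ρ : ℂ) - 1 / 2) * t) - 1) / ((ρ : ℂ) - 1 / 2) ^ 2))
        (Z.psi t : ℂ)

end Summit.RiemannHypothesis.RiemannHypothesis.Theorems.Splittings.ScrewLatticeTower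

end
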